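import Mathlib
import Summits.ValiantsHypothesis.ValiantsHypothesis.Theorems.LiouvilleSarnakAlignedTypeICharactersMod2nBilinearSieveGrowthTools
import HarnessLib

/-!
# Route LiouvilleSarnak — support `AlignedTypeI` (stmt-ValiantsHypothesis-21040), line `characters_mod_2n`:
# polynomial growth of `L(s, χ mod 2^j)` near `σ = 1` from short character sums (Abel summation)

`…BilinearSieveZeroFreeFromGrowth.lean` closed the leaf modulo the growth hypothesis

  `HG(C) := ∀ K > 0 ∃ j₀ ∀ j ≥ j₀ ∀ χ ≠ χ₀ (mod 2^j) ∀ z, 1 − K log²j/j ≤ Re z ≤ 2, |Im z| ≤ 2j³ + 1 ⟹ ‖L(z, χ)‖ ≤ j^C`.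

This file proves `HG(5)` from a bound for INITIAL SEGMENTS of primitive character sums to `2`-power moduli of
Vinogradov–Gallagher shape,

  `HS(C₁, c) := ∀ j ≥ 1 ∀ χ primitive (mod 2^j) ∀ 1 ≤ N ≤ 2^j, ‖Σ_{n ≤ N} χ(n)‖ ≤ C₁ N exp(−c log³N / log²(2^j))`

(Postnikov 1956 / Gallagher 1972 / Iwaniec 1974: the depth-aspect analogue of Vinogradov's zeta-sum estimate, Ivić
Thm 6.2), by Abel summation on `Re s > 0` (the tree's `DirichletAbel.LFunction_sub_sum_eq`, MV §4.3 with Thm 1.3):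
with `σ = Re z ≥ 1 − w`, `w = K log²j/j`, and `χ'` the primitive character (mod `q = 2^{j'}`, `j' ≤ j`) inducing `χ`
(`L(z, χ) = L(z, χ')` since `χ'(2) = 0`),

* every Abel term `S(N)(N^{-z} − (N+1)^{-z})`, `N ≤ q`, is `≤ (C₁ + 2)‖z‖/N` — trivially (`|S(N)| ≤ N`, `N^w ≤ 2`) when
  `log N < T = log 2/w`, and by `HS` when `log N ≥ T` (then `w log N ≤ c log³N/log²q` because `w³ j² ≤ c`, i.e.
  `K³ log⁶j ≤ c j`) (`bound_dichotomy`);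
* every `|S(N)|` is `≤ √q + C₁ q e^{−c log q/8}` (periodicity + `HS` on `[√q, q]`, `bound_period`), so the tail
  `Σ_{N > q}` is `≤ 2‖z‖(√q + C₁ q^{1 − c/8}) q^{−σ} ≤ 2(1 + C₁)‖z‖` once `w ≤ min(1/2, c/8)`
  (`RichertFromExpSum.tsum_rpow_tail_le`);

whence `‖L(z, χ)‖ ≤ ‖z‖ (C₁ + 2)(3 + log q) ≤ (2j³ + 3)(C₁ + 2)(3 + j) ≤ j⁵`.

(tools — reduction to primitive characters, the Bernoulli tail, the two dichotomies — in `…BilinearSieveGrowthTools.lean`)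
* `LFunctionGrowth_of_shortCharSums` — ★ `HS(C₁, c) → HG(5)`;
* `alignedTypeI_of_shortCharSums` — ★★ `HS(C₁, c) → AlignedTypeI` BY NAME.

After this file the leaf's residual is exactly `HS`: the `q = 2^j` analogue of Ivić's Theorem 6.2, to be proved from
Postnikov's formula `χ(1 + 2^τ u) = e(F(u))` and the tree's PROVED Korobov bilinear bound `VKZeta.norm_Usum_pow_le` /
Vinogradov mean value theorem `J_le_four` (as `VinogradovZetaSumEstimate.lean` does in the `t`-aspect).

HONEST FRAMING. CONDITIONAL RESULT (hypothesis by arrow, no `def`); the leaf `AlignedTypeI` is NOT closed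
unconditionally here; nothing bears on `VP ≠ VNP` (NOT proved).
-/

set_option linter.dupNamespace false

noncomputable section

namespace Summit.ValiantsHypothesis.ValiantsHypothesis.Theorems.LiouvilleSarnak.AlignedTypeI.CharactersModTwoN

open Complex Filter Topology Finset
open Literature.NumberTheory.LFunctions

/-! ### The growth bound from short character sums -/

/-- ★ **`HG(5)` from Vinogradov–Gallagher short character sums `HS(C₁, c)`** (CONDITIONAL by arrow, no def).  If for
all `j ≥ 1`, all primitive `χ (mod 2^j)` and `1 ≤ N ≤ 2^j`, `‖Σ_{n ≤ N} χ(n)‖ ≤ C₁ N exp(−c log³N/log²(2^j))`, then for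
every `K > 0`, eventually in `j`, every `χ ≠ χ₀ (mod 2^j)` has `‖L(z, χ)‖ ≤ j⁵` on `1 − K log²j/j ≤ Re z ≤ 2`,
`|Im z| ≤ 2j³ + 1`.  Abel summation on `Re s > 0` (MV §4.3/Thm 1.3 — the tree's `DirichletAbel`), the dichotomy
`bound_dichotomy` for `N ≤ q` (threshold `T = log 2/w`, `w = K log²j/j`, admissible once `K³ log⁶j ≤ c j`) and the
period bound `bound_period` with the tail `RichertFromExpSum.tsum_rpow_tail_le` for `N > q`.
[cite: MontgomeryVaughan2007, §4.3 (4.23) and Thm. 4.8] -/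
theorem LFunctionGrowth_of_shortCharSums {C₁ c : ℝ} (hC₁ : 0 ≤ C₁) (hc : 0 < c)
    (hS : ∀ j : ℕ, 1 ≤ j → ∀ χ : DirichletCharacter ℂ (2 ^ j), χ.IsPrimitive → ∀ N : ℕ, 1 ≤ N → N ≤ 2 ^ j →
      ‖∑ n ∈ Finset.range N, χ ((n + 1 : ℕ) : ZMod (2 ^ j))‖ ≤
        C₁ * N * Real.exp (-c * Real.log N ^ 3 / Real.log ((2 : ℝ) ^ j) ^ 2)) :
    ∀ K : ℝ, 0 < K → ∃ j₀ : ℕ, ∀ j : ℕ, j₀ ≤ j → ∀ χ : DirichletCharacter ℂ (2 ^ j), χ ≠ 1 →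
      ∀ z : ℂ, 1 - K * Real.log j ^ 2 / j ≤ z.re → z.re ≤ 2 → |z.im| ≤ 2 * (j : ℝ) ^ 3 + 1 →
        ‖χ.LFunction z‖ ≤ (j : ℝ) ^ (5 : ℝ) := by
  intro K hK
  -- eventual conditions on `j`
  have hT2 := tendsto_log_pow_div_natCast 2
  have hT6 := tendsto_log_pow_div_natCast 6
  have hmin : 0 < min (1 / 2) (c / 8) / K := by positivity
  have hE1 : ∀ᶠ j : ℕ in atTop, 4 ≤ j := eventually_ge_atTop _
  have hE2 : ∀ᶠ j : ℕ in atTop, Real.log j ^ 2 / (j : ℝ) < min (1 / 2) (c / 8) / K :=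
    hT2.eventually (gt_mem_nhds hmin)
  have hE3 : ∀ᶠ j : ℕ in atTop, Real.log j ^ 6 / (j : ℝ) < c / K ^ 3 :=
    hT6.eventually (gt_mem_nhds (by positivity))
  have hE4 : ∀ᶠ j : ℕ in atTop, ⌈6 * (C₁ + 2)⌉₊ ≤ j := eventually_ge_atTop _
  obtain ⟨j₀, hj₀⟩ := Filter.eventually_atTop.1 (hE1.and (hE2.and (hE3.and hE4)))
  refine ⟨j₀, fun j hj χ hχ z hzre hzre2 hzim => ?_⟩
  obtain ⟨h1, h2, h3, h4⟩ := hj₀ j hj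
  haveI : NeZero (2 ^ j) := ⟨pow_ne_zero _ two_ne_zero⟩
  -- real bookkeeping at level `j`
  have hj4 : (4 : ℝ) ≤ j := by exact_mod_cast h1
  have hj0 : (0 : ℝ) < j := by linarith
  have hj1 : (1 : ℝ) ≤ j := by linarith
  set Λ : ℝ := Real.log j with hΛdef
  have hΛ1 : 1 ≤ Λ := by
    have hlog4 : 1 ≤ Real.log 4 := by
      rw [← Real.log_exp 1]
      exact Real.log_le_log (Real.exp_pos 1) (by have := Real.exp_one_lt_d9; linarith)
    exact hlog4.trans (Real.log_le_log (by norm_num) hj4)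
  have hΛ0 : 0 < Λ := by linarith
  set w : ℝ := K * Λ ^ 2 / j with hwdef
  clear_value Λ w
  have hw0 : 0 < w := by rw [hwdef]; positivity
  have hw_eq : w = K * (Λ ^ 2 / j) := by rw [hwdef]; ring
  have hw_half : w ≤ 1 / 2 := by
    rw [hw_eq]
    have : K * (Λ ^ 2 / j) ≤ K * (min (1 / 2) (c / 8) / K) := by gcongr
    have e : K * (min (1 / 2) (c / 8) / K) = min (1 / 2) (c / 8) := by field_simp
    linarith [min_le_left (1 / 2 : ℝ) (c / 8)]
  have hw_c : w ≤ c / 8 := by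
    rw [hw_eq]
    have : K * (Λ ^ 2 / j) ≤ K * (min (1 / 2) (c / 8) / K) := by gcongr
    have e : K * (min (1 / 2) (c / 8) / K) = min (1 / 2) (c / 8) := by field_simp
    linarith [min_le_right (1 / 2 : ℝ) (c / 8)]
  have hw3 : w ^ 3 * j ^ 2 ≤ c := by
    have e1 : w ^ 3 * j ^ 2 = K ^ 3 * (Λ ^ 6 / j) := by
      rw [hwdef]; field_simp
    rw [e1]
    have : K ^ 3 * (Λ ^ 6 / j) ≤ K ^ 3 * (c / K ^ 3) := by gcongr
    have e : K ^ 3 * (c / K ^ 3) = c := by field_simp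
    linarith
  -- `σ = Re z`
  have hznorm : ‖z‖ ≤ 2 * (j : ℝ) ^ 3 + 3 := by
    have h := Complex.norm_le_abs_re_add_abs_im z
    have hre : |z.re| ≤ 2 := by
      rw [abs_le]; constructor <;> linarith only [hzre, hzre2, hw_half]
    linarith only [h, hre, hzim]
  set σ : ℝ := z.re with hσdef
  clear_value σ
  have hσw : 1 - w ≤ σ := hzre
  have hσhalf : 1 / 2 ≤ σ := by linarith only [hzre, hw_half]
  have hσ0 : 0 < σ := by linarith only [hσhalf]
  have hs : 0 < z.re := by rw [← hσdef]; exact hσ0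
  -- the primitive character inducing `χ`
  obtain ⟨j', hj'1, hj'j, χ', hχ', hLeq⟩ := exists_primitive_twoPower_LFunction_eq j χ hχ
  haveI : NeZero (2 ^ j') := ⟨pow_ne_zero _ two_ne_zero⟩
  have hne : χ' ≠ 1 := ne_one_of_isPrimitive_twoPower hj'1 χ' hχ'
  rw [hLeq z]
  -- the level `q = 2^{j'}` and `L = log q`
  have hq1 : 1 ≤ 2 ^ j' := Nat.one_le_two_pow
  have hqR : ((2 ^ j' : ℕ) : ℝ) = (2 : ℝ) ^ j' := by push_cast; ring
  have hq0R : (0 : ℝ) < ((2 ^ j' : ℕ) : ℝ) := by positivity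
  set L : ℝ := Real.log ((2 : ℝ) ^ j') with hLdef
  clear_value L
  have hlog2 : 0 < Real.log 2 := Real.log_pos (by norm_num)
  have hlog2' : Real.log 2 < 1 := by
    have := Real.log_two_lt_d9; linarith
  have hL_eq : L = j' * Real.log 2 := by rw [hLdef, Real.log_pow]
  have hj'R : (1 : ℝ) ≤ j' := by exact_mod_cast hj'1
  have hj'jR : (j' : ℝ) ≤ j := by exact_mod_cast hj'j
  have hL0 : 0 < L := by rw [hL_eq]; positivity
  have hLj : L ≤ j := by rw [hL_eq]; nlinarith
  have hlogq : Real.log ((2 ^ j' : ℕ) : ℝ) = L := by rw [hqR, hLdef]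
  have hexpL : Real.exp L = ((2 ^ j' : ℕ) : ℝ) := by rw [← hlogq, Real.exp_log hq0R]
  -- the threshold `T = log 2 / w`
  set T : ℝ := Real.log 2 / w with hTdef
  clear_value T
  have hT0 : 0 ≤ T := by rw [hTdef]; positivity
  have hwT : w * T ≤ Real.log 2 := by rw [hTdef, mul_div_cancel₀ _ hw0.ne']
  have hwL : w * L ^ 2 ≤ c * T ^ 2 := by
    -- `w L² ≤ w j² ≤ w j² (log 2)²/(log 2)² …`: from `w³ j² ≤ c`, `c T² = c (log 2)²/w² ≥ w j² (log 2)² ≥ w L²`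
    rw [hTdef, div_pow, mul_div_assoc']
    rw [le_div_iff₀ (by positivity)]
    have hL2 : L ^ 2 ≤ (j' * Real.log 2) ^ 2 := by rw [hL_eq]
    have h1 : w * L ^ 2 * w ^ 2 = w ^ 3 * L ^ 2 := by ring
    rw [h1]
    have h2 : L ^ 2 ≤ (j : ℝ) ^ 2 * Real.log 2 ^ 2 := by
      rw [hL_eq, mul_pow]
      gcongr
    calc w ^ 3 * L ^ 2 ≤ w ^ 3 * ((j : ℝ) ^ 2 * Real.log 2 ^ 2) := by gcongr
      _ = (w ^ 3 * j ^ 2) * Real.log 2 ^ 2 := by ring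
      _ ≤ c * Real.log 2 ^ 2 := by gcongr
  -- the two bounds on `‖S(N)‖`, `1 ≤ N ≤ q = 2^{j'}`
  have hSN : ∀ N : ℕ, 1 ≤ N → N ≤ (2 ^ j') →
      ‖DirichletAbel.partialSum χ' N‖ ≤ Real.exp (Real.log N) ∧
      ‖DirichletAbel.partialSum χ' N‖ ≤
        C₁ * Real.exp (Real.log N) * Real.exp (-c * Real.log N ^ 3 / L ^ 2) := by
    intro N hN1 hNq
    have hN0 : (0 : ℝ) < N := by exact_mod_cast (show 0 < N by omega)
    rw [Real.exp_log hN0]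
    refine ⟨DirichletAbel.norm_partialSum_le_self χ' N, ?_⟩
    have h := hS j' hj'1 χ' hχ' N hN1 hNq
    rw [← hLdef] at h
    exact h
  -- (i) the Abel terms with `N ≤ q`: `‖S(N)‖ ≤ (C₁ + 2) N^σ`
  have hterm : ∀ n : ℕ, n < (2 ^ j') →
      ‖DirichletAbel.term χ' n z‖ ≤ (C₁ + 2) * ‖z‖ * (1 / ((n + 1 : ℕ) : ℝ)) := by
    intro n hn
    have hN0 : (0 : ℝ) < ((n + 1 : ℕ) : ℝ) := by positivity
    have hN1 : (1 : ℝ) ≤ ((n + 1 : ℕ) : ℝ) := by exact_mod_cast Nat.succ_pos n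
    obtain ⟨hS1, hS2⟩ := hSN (n + 1) (by omega) (by omega)
    have hl0 : 0 ≤ Real.log ((n + 1 : ℕ) : ℝ) := Real.log_nonneg hN1
    have hbd := bound_dichotomy hl0 hC₁ hc hw0.le hL0 hT0 hσw hwT hwL hS1 hS2
    -- `e^{σ log N} = N^σ`, and `N^σ · N^{-σ-1} = 1/N`
    have hpow : Real.exp (σ * Real.log ((n + 1 : ℕ) : ℝ)) * ((n + 1 : ℕ) : ℝ) ^ (-σ - 1) =
        1 / ((n + 1 : ℕ) : ℝ) := by
      rw [mul_comm σ, ← Real.rpow_def_of_pos hN0, ← Real.rpow_add hN0,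
        show σ + (-σ - 1) = -1 by ring, Real.rpow_neg_one, one_div]
    calc ‖DirichletAbel.term χ' n z‖
        ≤ ‖DirichletAbel.partialSum χ' (n + 1)‖ * (‖z‖ * ((n + 1 : ℕ) : ℝ) ^ (-z.re - 1)) :=
          DirichletAbel.norm_term_le' χ' n hs
      _ ≤ (C₁ + 2) * Real.exp (σ * Real.log ((n + 1 : ℕ) : ℝ)) *
            (‖z‖ * ((n + 1 : ℕ) : ℝ) ^ (-σ - 1)) := by
          rw [← hσdef]
          exact mul_le_mul_of_nonneg_right hbd (by positivity)
      _ = (C₁ + 2) * ‖z‖ * (Real.exp (σ * Real.log ((n + 1 : ℕ) : ℝ)) * ((n + 1 : ℕ) : ℝ) ^ (-σ - 1)) := by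
          ring
      _ = (C₁ + 2) * ‖z‖ * (1 / ((n + 1 : ℕ) : ℝ)) := by rw [hpow]
  -- (ii) the uniform bound `‖S(N)‖ ≤ B` for all `N`
  set B : ℝ := Real.exp (L / 2) + C₁ * Real.exp L * Real.exp (-c * L / 8) with hBdef
  clear_value B
  have hB0 : 0 ≤ B := by rw [hBdef]; positivity
  have hSB : ∀ N : ℕ, ‖DirichletAbel.partialSum χ' N‖ ≤ B := by
    refine norm_partialSum_le_of_le χ' hne fun N hNq => ?_
    rcases Nat.eq_zero_or_pos N with rfl | hNpos
    · simp [hB0]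
    obtain ⟨hS1, hS2⟩ := hSN N hNpos hNq
    have hN0 : (0 : ℝ) < N := by exact_mod_cast hNpos
    have hN1 : (1 : ℝ) ≤ N := by exact_mod_cast hNpos
    have hl0 : 0 ≤ Real.log (N : ℝ) := Real.log_nonneg hN1
    have hlL : Real.log (N : ℝ) ≤ L := by
      rw [← hlogq]; exact Real.log_le_log hN0 (by exact_mod_cast hNq)
    rw [hBdef]
    exact bound_period hlL hL0 hc.le hC₁ hS1 hS2
  -- `B q^{-σ} ≤ 1 + C₁`
  have hBq : B * ((2 ^ j' : ℕ) : ℝ) ^ (-σ) ≤ 1 + C₁ := by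
    have hqσ : ((2 ^ j' : ℕ) : ℝ) ^ (-σ) = Real.exp (-σ * L) := by
      rw [Real.rpow_def_of_pos hq0R, hlogq]; ring_nf
    rw [hqσ, hBdef, add_mul]
    have e1 : Real.exp (L / 2) * Real.exp (-σ * L) = Real.exp ((1 / 2 - σ) * L) := by
      rw [← Real.exp_add]; ring_nf
    have e2 : C₁ * Real.exp L * Real.exp (-c * L / 8) * Real.exp (-σ * L) =
        C₁ * Real.exp ((1 - σ - c / 8) * L) := by
      rw [mul_assoc, mul_assoc, ← Real.exp_add, ← Real.exp_add]; ring_nf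
    rw [e1, e2]
    have h1 : Real.exp ((1 / 2 - σ) * L) ≤ 1 :=
      Real.exp_le_one_iff.2 (mul_nonpos_of_nonpos_of_nonneg (by linarith only [hσhalf]) hL0.le)
    have h2 : Real.exp ((1 - σ - c / 8) * L) ≤ 1 :=
      Real.exp_le_one_iff.2 (mul_nonpos_of_nonpos_of_nonneg (by linarith only [hσw, hw_c]) hL0.le)
    have h3 : C₁ * Real.exp ((1 - σ - c / 8) * L) ≤ C₁ * 1 := mul_le_mul_of_nonneg_left h2 hC₁
    linarith only [h1, h3]
  -- Abel summation: `L(z, χ') = Σ_{n<q} term n + Σ_n term (n+q)` (`S(q) = 0`)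
  have hSq : DirichletAbel.partialSum χ' (2 ^ j') = 0 := by
    have := DirichletAbel.partialSum_add_level χ' hne 0
    rwa [zero_add, DirichletAbel.partialSum_zero] at this
  have hdecomp : χ'.LFunction z =
      ∑ n ∈ range (2 ^ j'), DirichletAbel.term χ' n z + ∑' n : ℕ, DirichletAbel.term χ' (n + (2 ^ j')) z := by
    have h := DirichletAbel.LFunction_sub_sum_eq χ' hne hs (2 ^ j')
    rw [DirichletAbel.sum_apply_mul_cpow_eq χ' z (2 ^ j'), hSq, zero_mul, zero_add, sub_zero] at h
    linear_combination h
  -- the head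
  have hhead : ‖∑ n ∈ range (2 ^ j'), DirichletAbel.term χ' n z‖ ≤ (C₁ + 2) * ‖z‖ * (1 + L) := by
    calc ‖∑ n ∈ range (2 ^ j'), DirichletAbel.term χ' n z‖ ≤ ∑ n ∈ range (2 ^ j'), ‖DirichletAbel.term χ' n z‖ :=
          norm_sum_le _ _
      _ ≤ ∑ n ∈ range (2 ^ j'), (C₁ + 2) * ‖z‖ * (1 / ((n + 1 : ℕ) : ℝ)) :=
          sum_le_sum fun n hn => hterm n (mem_range.1 hn)
      _ = (C₁ + 2) * ‖z‖ * ∑ n ∈ range (2 ^ j'), 1 / ((n + 1 : ℕ) : ℝ) := by rw [mul_sum]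
      _ ≤ (C₁ + 2) * ‖z‖ * (1 + L) := by
          rw [← hlogq]
          exact mul_le_mul_of_nonneg_left (VKFromRichert.sum_range_one_div_succ_le (2 ^ j')) (by positivity)
  -- the tail
  have htail : ‖∑' n : ℕ, DirichletAbel.term χ' (n + (2 ^ j')) z‖ ≤ 2 * (1 + C₁) * ‖z‖ := by
    have hsum : Summable fun n : ℕ => ((n + (2 ^ j') + 1 : ℕ) : ℝ) ^ (-σ - 1) :=
      (DirichletAbel.summable_rpow_neg hσ0).comp_injective (add_left_injective (2 ^ j'))
    have hg := (hsum.mul_left (B * ‖z‖)).hasSum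
    have hle : ∀ n : ℕ, ‖DirichletAbel.term χ' (n + (2 ^ j')) z‖ ≤ B * ‖z‖ * ((n + (2 ^ j') + 1 : ℕ) : ℝ) ^ (-σ - 1) := by
      intro n
      calc ‖DirichletAbel.term χ' (n + (2 ^ j')) z‖
          ≤ ‖DirichletAbel.partialSum χ' (n + (2 ^ j') + 1)‖ * (‖z‖ * ((n + (2 ^ j') + 1 : ℕ) : ℝ) ^ (-z.re - 1)) :=
            DirichletAbel.norm_term_le' χ' (n + (2 ^ j')) hs
        _ ≤ B * (‖z‖ * ((n + (2 ^ j') + 1 : ℕ) : ℝ) ^ (-σ - 1)) := by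
            rw [← hσdef]
            exact mul_le_mul_of_nonneg_right (hSB _) (by positivity)
        _ = B * ‖z‖ * ((n + (2 ^ j') + 1 : ℕ) : ℝ) ^ (-σ - 1) := by ring
    have h1 := tsum_of_norm_bounded hg hle
    have h2 : ∑' n : ℕ, B * ‖z‖ * ((n + (2 ^ j') + 1 : ℕ) : ℝ) ^ (-σ - 1) ≤ B * ‖z‖ * (((2 ^ j' : ℕ) : ℝ) ^ (-σ) / σ) := by
      rw [tsum_mul_left]
      exact mul_le_mul_of_nonneg_left (RichertFromExpSum.tsum_rpow_tail_le hσ0 hq1) (by positivity)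
    have h3 : B * ‖z‖ * (((2 ^ j' : ℕ) : ℝ) ^ (-σ) / σ) ≤ B * ‖z‖ * (((2 ^ j' : ℕ) : ℝ) ^ (-σ) * 2) := by
      refine mul_le_mul_of_nonneg_left ?_ (by positivity)
      rw [div_le_iff₀ hσ0]
      have hx : 0 ≤ ((2 ^ j' : ℕ) : ℝ) ^ (-σ) := by positivity
      have h2σ : (1 : ℝ) ≤ 2 * σ := by linarith only [hσhalf]
      calc ((2 ^ j' : ℕ) : ℝ) ^ (-σ) = ((2 ^ j' : ℕ) : ℝ) ^ (-σ) * 1 := (mul_one _).symm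
        _ ≤ ((2 ^ j' : ℕ) : ℝ) ^ (-σ) * (2 * σ) := mul_le_mul_of_nonneg_left h2σ hx
        _ = ((2 ^ j' : ℕ) : ℝ) ^ (-σ) * 2 * σ := by ring
    calc ‖∑' n : ℕ, DirichletAbel.term χ' (n + (2 ^ j')) z‖ ≤ B * ‖z‖ * (((2 ^ j' : ℕ) : ℝ) ^ (-σ) * 2) :=
          h1.trans (h2.trans h3)
      _ = 2 * ‖z‖ * (B * ((2 ^ j' : ℕ) : ℝ) ^ (-σ)) := by ring
      _ ≤ 2 * ‖z‖ * (1 + C₁) := by gcongr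
      _ = 2 * (1 + C₁) * ‖z‖ := by ring
  -- assembly
  have hj5 : (j : ℝ) ^ (5 : ℝ) = (j : ℝ) ^ (5 : ℕ) := by exact_mod_cast Real.rpow_natCast (j : ℝ) 5
  rw [hdecomp, hj5]
  have h6C : 6 * (C₁ + 2) ≤ (j : ℝ) := le_trans (Nat.le_ceil _) (by exact_mod_cast h4)
  calc ‖∑ n ∈ range (2 ^ j'), DirichletAbel.term χ' n z + ∑' n : ℕ, DirichletAbel.term χ' (n + (2 ^ j')) z‖
      ≤ (C₁ + 2) * ‖z‖ * (1 + L) + 2 * (1 + C₁) * ‖z‖ := (norm_add_le _ _).trans (add_le_add hhead htail)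
    _ ≤ (C₁ + 2) * ‖z‖ * (1 + j) + 2 * (C₁ + 2) * ‖z‖ := by
        have hz0 : 0 ≤ ‖z‖ := norm_nonneg z
        have e1 : (C₁ + 2) * ‖z‖ * (1 + L) ≤ (C₁ + 2) * ‖z‖ * (1 + j) := by gcongr
        have e2 : 2 * (1 + C₁) * ‖z‖ ≤ 2 * (C₁ + 2) * ‖z‖ :=
          mul_le_mul_of_nonneg_right (by linarith) hz0
        linarith only [e1, e2]
    _ = (C₁ + 2) * ‖z‖ * (3 + j) := by ring
    _ ≤ (C₁ + 2) * (2 * (j : ℝ) ^ 3 + 3) * (3 + j) := by gcongr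
    _ ≤ (C₁ + 2) * (3 * (j : ℝ) ^ 3) * (2 * j) := by
        have hj64 : (4 : ℝ) ^ 3 ≤ (j : ℝ) ^ 3 := pow_le_pow_left₀ (by norm_num) hj4 3
        have hj3 : 2 * (j : ℝ) ^ 3 + 3 ≤ 3 * (j : ℝ) ^ 3 := by norm_num at hj64; linarith only [hj64]
        have hj2 : 3 + (j : ℝ) ≤ 2 * j := by linarith only [hj4]
        gcongr
    _ = 6 * (C₁ + 2) * (j : ℝ) ^ 4 := by ring
    _ ≤ (j : ℝ) * (j : ℝ) ^ 4 := by gcongr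
    _ = (j : ℝ) ^ (5 : ℕ) := by ring

/-- ★★ **`AlignedTypeI` from Vinogradov–Gallagher short character sums to `2`-power moduli** (CONDITIONAL by arrow on
`HS(C₁, c)`): composition of `LFunctionGrowth_of_shortCharSums` with `alignedTypeI_of_LFunctionGrowth`.  `HS` is the
depth-aspect analogue of Ivić's Theorem 6.2 (Postnikov 1956, Gallagher 1972, Iwaniec 1974: `Σ_{n ≤ N} χ(n) ≪
N exp(−c log³N/log²q)` for primitive `χ (mod q = 2^j)`), to be proved from Postnikov's formula and the tree's proved
Vinogradov mean value theorem / Korobov bound. [folklore] -/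
theorem alignedTypeI_of_shortCharSums {C₁ c : ℝ} (hC₁ : 0 ≤ C₁) (hc : 0 < c)
    (hS : ∀ j : ℕ, 1 ≤ j → ∀ χ : DirichletCharacter ℂ (2 ^ j), χ.IsPrimitive → ∀ N : ℕ, 1 ≤ N → N ≤ 2 ^ j →
      ‖∑ n ∈ Finset.range N, χ ((n + 1 : ℕ) : ZMod (2 ^ j))‖ ≤
        C₁ * N * Real.exp (-c * Real.log N ^ 3 / Real.log ((2 : ℝ) ^ j) ^ 2)) :
    Summit.ValiantsHypothesis.ValiantsHypothesis.Theses.LiouvilleSarnak.AlignedTypeI :=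
  alignedTypeI_of_LFunctionGrowth 5 (LFunctionGrowth_of_shortCharSums hC₁ hc hS)

end Summit.ValiantsHypothesis.ValiantsHypothesis.Theorems.LiouvilleSarnak.AlignedTypeI.CharactersModTwoN
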